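import Literature.MathematicalPhysics.QuantumLattice.LatticeGaugeDLRGibbsProofs
import HarnessLib

/-!
# Helper `mixtureCovarianceFloor` of line `Sketch`, crux `FibreToTorus` (stmt-QuantumFields-16244)

First lemma `MixtureCovarianceFloor` of idea card `flux-sector-ledger`: if a state is a finite
MIXTURE `P = Σ_e w_e P_e` (`w_e ≥ 0`, `Σ_e w_e = 1`) of probability laws on the `ℤ⁴`-gauge
configurations `LGConfig 4 G`, each invariant under a measurable map `τ` (the time translation;
the `P_e` are the electric-flux sectors), then for bounded measurable observables `A`, `B` the
connected correlation of `A` and `B ∘ τ` in `P` is the mixture of the sector covariances PLUS the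
(translation independent) variance floor of the sector means:

`Cov_P(A, B∘τ) = Σ_e w_e Cov_{P_e}(A, B∘τ) + ½ Σ_{e,e'} w_e w_{e'} (⟨A⟩_e - ⟨A⟩_{e'}) (⟨B⟩_e - ⟨B⟩_{e'})`.

Proof: linearity of the Bochner integral in the measure (`integral_finsetSum_measure`,
`integral_smul_measure`), `τ`-invariance of each `P_e` (`∫ B∘τ dP_e = ∫ B dP_e`), and the finite
algebraic identity `Σ w_e a_e b_e − (Σ w_e a_e)(Σ w_e b_e) = ½ ΣΣ w_e w_{e'} (a_e − a_{e'})(b_e − b_{e'})`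
under `Σ w_e = 1` (`mixture_variance_identity`).
-/

noncomputable section

open MeasureTheory Filter Topology Finset
open Literature.MathematicalPhysics.QuantumLattice (LGConfig ZdEdge configShift integrable_of_bound)

namespace Summit.QuantumFields.YangMills.Theorems.FibreToTorus

/-- **Law of total covariance for a finite mixture (pure algebra).**  For weights `w` with
`Σ_e w_e = 1` and reals `a_e, b_e, c_e`,
`Σ w_e c_e − (Σ w_e a_e)(Σ w_e b_e) = Σ w_e (c_e − a_e b_e) + ½ ΣΣ w_e w_{e'} (a_e − a_{e'})(b_e − b_{e'})`:
the variance of the sector means written as half the mixture-weighted sum of squared differences.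
[folklore] -/
theorem mixture_variance_identity {k : ℕ} (w a b c : Fin k → ℝ) (hw1 : ∑ e, w e = 1) :
    (∑ e, w e * c e) - (∑ e, w e * a e) * (∑ e, w e * b e) =
      (∑ e, w e * (c e - a e * b e)) +
        (1 / 2) * ∑ e, ∑ e', w e * w e' * ((a e - a e') * (b e - b e')) := by
  -- expand the inner sum
  have inner : ∀ e, ∑ e', w e * w e' * ((a e - a e') * (b e - b e')) =
      w e * (a e * b e) * (∑ e', w e') - w e * a e * (∑ e', w e' * b e') -
        w e * b e * (∑ e', w e' * a e') + w e * (∑ e', w e' * (a e' * b e')) := by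
    intro e
    rw [Finset.mul_sum, Finset.mul_sum, Finset.mul_sum, Finset.mul_sum, ← Finset.sum_sub_distrib,
      ← Finset.sum_sub_distrib, ← Finset.sum_add_distrib]
    exact Finset.sum_congr rfl fun e' _ => by ring
  -- sum the expansion over `e`
  have hD : ∑ e, ∑ e', w e * w e' * ((a e - a e') * (b e - b e')) =
      (∑ e, w e * (a e * b e)) * (∑ e', w e') - (∑ e, w e * a e) * (∑ e', w e' * b e') -
        (∑ e, w e * b e) * (∑ e', w e' * a e') + (∑ e, w e) * (∑ e', w e' * (a e' * b e')) := by
    rw [Finset.sum_mul, Finset.sum_mul, Finset.sum_mul, Finset.sum_mul, ← Finset.sum_sub_distrib,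
      ← Finset.sum_sub_distrib, ← Finset.sum_add_distrib]
    exact Finset.sum_congr rfl fun e _ => inner e
  have hc : ∑ e, w e * (c e - a e * b e) = (∑ e, w e * c e) - ∑ e, w e * (a e * b e) := by
    rw [← Finset.sum_sub_distrib]
    exact Finset.sum_congr rfl fun e _ => by ring
  rw [hw1] at hD
  linear_combination (-1 / 2 : ℝ) * hD - hc

/-- **`MixtureCovarianceFloor` (card `flux-sector-ledger`, first lemma; registered helper of line
`Sketch`).**  For a finite mixture `P = Σ_e w_e P_e` of `τ`-invariant probability measures on
`LGConfig 4 G` (`w_e ≥ 0`, `Σ_e w_e = 1`, `(P_e).map τ = P_e`) and bounded measurable `A`, `B`,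
the connected correlation `∫ A · B∘τ dP − (∫ A dP)(∫ B∘τ dP)` equals the mixture
`Σ_e w_e Cov_{P_e}(A, B∘τ)` of the sector covariances plus the variance floor
`½ Σ_{e,e'} w_e w_{e'} (∫ A dP_e − ∫ A dP_{e'}) (∫ B dP_e − ∫ B dP_{e'})` of the sector means
(law of total covariance; linearity of the integral in the measure, `τ`-invariance, and
`mixture_variance_identity`). -/
theorem mixtureCovarianceFloor : ∀ (G : Type) [MeasurableSpace G] (k : ℕ) (w : Fin k → ℝ) (P : Fin k → MeasureTheory.Measure (LGConfig 4 G)) (τ : LGConfig 4 G → LGConfig 4 G) (A B : LGConfig 4 G → ℝ), (∀ e, MeasureTheory.IsProbabilityMeasure (P e)) → (∀ e, 0 ≤ w e) → ∑ e, w e = 1 → Measurable τ → (∀ e, (P e).map τ = P e) → Measurable A → Measurable B → (∀ U, |A U| ≤ 1) → (∀ U, |B U| ≤ 1) → (∫ U, A U * B (τ U) ∂(∑ e, ENNReal.ofReal (w e) • P e)) - (∫ U, A U ∂(∑ e, ENNReal.ofReal (w e) • P e)) * (∫ U, B (τ U) ∂(∑ e, ENNReal.ofReal (w e) • P e)) =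 (∑ e, w e * ((∫ U, A U * B (τ U) ∂P e) - (∫ U, A U ∂P e) * ∫ U, B (τ U) ∂P e)) + (1 / 2) * ∑ e, ∑ e', w e * w e' * (((∫ U, A U ∂P e) - ∫ U, A U ∂P e') * ((∫ U, B U ∂P e) - ∫ U, B U ∂P e')) := by
  intro G _ k w P τ A B hP hw hw1 hτ hPτ hA hB hAb hBb
  -- integrability of the bounded measurable integrands with respect to each sector law
  have hBτ : Measurable fun U => B (τ U) := hB.comp hτ
  have hABτ : Measurable fun U => A U * B (τ U) := hA.mul hBτ
  have iA : ∀ e, Integrable A (P e) := fun e => integrable_of_bound hA.aestronglyMeasurable hAb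
  have iBτ : ∀ e, Integrable (fun U => B (τ U)) (P e) := fun e =>
    integrable_of_bound hBτ.aestronglyMeasurable fun U => hBb (τ U)
  have iABτ : ∀ e, Integrable (fun U => A U * B (τ U)) (P e) := fun e =>
    integrable_of_bound hABτ.aestronglyMeasurable fun U => by
      rw [abs_mul]
      exact mul_le_one₀ (hAb U) (abs_nonneg _) (hBb (τ U))
  -- linearity of the integral in the measure
  have lin : ∀ f : LGConfig 4 G → ℝ, (∀ e, Integrable f (P e)) →
      ∫ U, f U ∂(∑ e, ENNReal.ofReal (w e) • P e) = ∑ e, w e * ∫ U, f U ∂(P e) := by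
    intro f hf
    rw [integral_finsetSum_measure fun e _ => (hf e).smul_measure ENNReal.ofReal_ne_top]
    refine Finset.sum_congr rfl fun e _ => ?_
    rw [integral_smul_measure, ENNReal.toReal_ofReal (hw e), smul_eq_mul]
  -- `τ`-invariance of the sector laws
  have inv : ∀ e, ∫ U, B (τ U) ∂(P e) = ∫ U, B U ∂(P e) := by
    intro e
    rw [← integral_map_of_stronglyMeasurable hτ hB.stronglyMeasurable, hPτ e]
  rw [lin _ iABτ, lin _ iA, lin _ iBτ]
  simp_rw [inv]
  exact mixture_variance_identity w (fun e => ∫ U, A U ∂(P e)) (fun e => ∫ U, B U ∂(P e))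
    (fun e => ∫ U, A U * B (τ U) ∂(P e)) hw1

end Summit.QuantumFields.YangMills.Theorems.FibreToTorus

end
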